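import Mathlib.Analysis.Calculus.FDeriv.Equiv
import Mathlib.Analysis.Calculus.LineDeriv.Basic
import Mathlib.Analysis.SpecialFunctions.Integrals.Basic
import Mathlib.MeasureTheory.Group.Measure
import Mathlib.MeasureTheory.Measure.Haar.NormedSpace
import Mathlib.MeasureTheory.Measure.Lebesgue.VolumeOfBalls
import Mathlib.MeasureTheory.Constructions.HaarToSphere
import Literature.Geometry.Riemannian.LevelSetGaussBonnet
import HarnessLib

/-!
# The isobar Euler budget `B(q; a, b)` of a scalar field on `ℝ³`

Analysis/FluidPDE definition file (item `defn-isobarEulerBudget`; wanted by route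
`NavierStokesRegularity/IsobarTomography`, item stmt-NavierStokesRegularity-11739 and its foreseen
layer-2 children, and by the card `isobar-curvature-tomography-pressure-hessian`, objects (GB)/(C)).

For `q : ℝ³ → ℝ` (a pressure, at fixed time) and levels `a < b` the **isobar Euler budget** is

  `B(q; a, b) := 2 ∫_{x : a < q(x) < b} ⟨∇q(x), adj(∇²q(x)) ∇q(x)⟩ / ‖∇q(x)‖³ dx`

(`isobarEulerBudget`), where `∇²q(x)` is the Hessian as a `3 × 3` matrix in the standard basis —
the tree's `Literature.Geometry.Riemannian.hessianMatrix` (`LevelSetGaussBonnet.lean`) —, `adj` is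
`Matrix.adjugate`, the integrand (`isobarEulerDensity`) is `0` where `∇q(x) = 0`, and the integral
is the Bochner integral for Lebesgue measure on the open slab `q⁻¹(a, b)` (junk value `0` if the
density is not integrable there).

## Why this integrand (sources), and what the tree already has

* Goldman 2005, eq. (4.1) / Thm 4.1 (p. 642): the Gauss curvature of the implicit surface `F = 0`
  is `K_G = ∇F · H*(F) · ∇Fᵀ / |∇F|⁴`, `H*(F)` the adjoint (adjugate) of the Hessian — in the tree
  as the DEFINITION `Literature.Geometry.Riemannian.levelSetGaussCurvature`, with
  `levelSetGaussCurvature_mul_norm : K · ‖∇q‖ = ∇qᵀ adj(∇²q) ∇q / ‖∇q‖³`. Hence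
  `isobarEulerDensity q x = levelSetGaussCurvature q x * ‖∇q(x)‖`
  (`isobarEulerDensity_eq_gaussCurvature_mul_norm`, by `rfl` up to that lemma).
* Stern 2022 (= arXiv:1908.09754), §2: for regular values, "by the coarea formula and the
  Gauss–Bonnet theorem" `∫_{u⁻¹(B)} (|du|/2) R_Σ = ∫_B 2π χ(Σ_θ) dθ` (`R_Σ = 2 K_Σ`) — in the tree
  as the NAMED FACT `Literature.Geometry.Riemannian.levelSet_gaussBonnet_coarea` (not proved:
  Mathlib has neither coarea nor Gauss–Bonnet) with the slab corollary `.slab_Ioo`. Consumed here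
  as a hypothesis: `isobarEulerBudget_eq_of_gaussBonnet (h : levelSet_gaussBonnet_coarea) … :
  B(q; a, b) = 4π ∫_{[a,b]} χ(Σ_s) ds` for smooth `q` with `q⁻¹[a, b]` compact and regular —
  nested spheres (`χ = 2`) cost `8π` per unit depth, tubes/tori (`χ = 0`) cost nothing.

## API (all proved; no regularity hypotheses unless stated; no new named fact)

* `isobarEulerDensity_eq_gaussCurvature_mul_norm`, `isobarEulerBudget_eq_of_gaussBonnet` (above);
* `isobarEulerDensity_eq_zero_of_gradient_eq_zero`, `isobarEulerBudget_of_le` (empty slab);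
* orientation: `isobarEulerDensity_fun_neg`, `isobarEulerBudget_fun_neg`
  (`B(-q; -b, -a) = B(q; a, b)` — `χ` does not see the orientation of `Σ_s`);
* amplitude: `B(cq; ca, cb) = c B(q; a, b)` for `c > 0` (`isobarEulerBudget_const_mul`);
  dilation: `B(q(λ·); a, b) = B(q; a, b)` for `λ > 0` (`isobarEulerBudget_comp_smul`);
  translation: `isobarEulerBudget_comp_add_right`; together the **Navier–Stokes scaling**
  `B(λ²q(λ·); λ²a, λ²b) = λ² B(q; a, b)` (`isobarEulerBudget_nsScaling`: the budget has the
  dimension of `q`, so its time integral over a parabolic cylinder is scaling-critical — the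
  card's counter (C), not defined here); the underlying hypothesis-free Hessian laws
  `hessianMatrix_fun_neg`, `hessianMatrix_const_mul'`, `hessianMatrix_comp_smul`,
  `hessianMatrix_comp_add_right` extend the tree's `hessianMatrix` API;
* columns: if `q` is invariant in a coordinate direction (`z`-invariant `q(x, y)`), the density
  vanishes identically and `B = 0` (`isobarEulerBudget_eq_zero_of_invariant`);
* the round example: for `q = ‖·‖²` the density is `2/‖x‖` (`isobarEulerDensity_norm_sq`, from the
  tree's `levelSetGaussCurvature_norm_sq : K = 1/‖x‖²`) and **`B(‖·‖²; a, b) = 8π (b - a)`** for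
  `0 ≤ a ≤ b` (`isobarEulerBudget_norm_sq`, by polar coordinates) — matching `4π ∫_a^b χ(S²) ds`
  unconditionally.

## Design notes

* The quadratic form is written with `dotProduct`/`mulVec` on the coordinate vector
  `WithLp.ofLp (gradient q x) : Fin 3 → ℝ`, literally the integrand of
  `levelSet_gaussBonnet_coarea.slab_Ioo` and the shape of the route's support item
  `GaussKroneckerSplit` (`n ⬝ᵥ (M.adjugate *ᵥ n)` for symmetric `M`, unit `n`; symmetry of
  `∇²q` for `q ∈ C²` is the tree's `hessianMatrix_isSymm`).
* Division by `‖∇q‖³ = 0` returns `0`: critical points contribute nothing (regular level sets are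
  Lebesgue-null anyway, `volume_preimage_singleton_eq_zero_of_gradient_ne_zero` in the tree).
* Deliberately NOT here: the Morse-count form `8π Σ_c (-1)^{ind c} (b - q(c))₊`, the deviatoric
  split of the integrand (route item `GaussKroneckerSplit`), the time-integrated counter over
  parabolic cylinders, and `deviatoricHessian` (separate definition request).

## References

* R. Goldman, *Curvature formulas for implicit curves and surfaces*, Comput. Aided Geom. Design 22
  (2005) 632–658, §4, eq. (4.1), Thm 4.1, Example 4.1. [Goldman2005]
* D. Stern, *Scalar curvature and harmonic maps to S¹*, J. Differential Geom. 122 (2022),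
  arXiv:1908.09754, §2. [Stern2022]
-/

noncomputable section

open MeasureTheory Set WithLp Matrix InnerProductSpace
open Literature.Geometry.Riemannian
open scoped RealInnerProductSpace Pointwise ContDiff

namespace Literature.Analysis.FluidPDE

/-! ### Hypothesis-free calculus of `gradient` and of the tree's `hessianMatrix` -/

section Hessian

variable {n : ℕ}

/-- Coordinates of the gradient in the standard basis are the partial derivatives,
`(∇q(x))ᵢ = Dq(x) eᵢ` (a copy of the tree's `gradient_apply_eq_fderiv_single` /
`gradient_apply_eq_fderiv` of `AxisymGradientField` / `TaoAveragedEulerLerayL2`, restated to keep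
this file's imports light). [folklore] -/
private theorem gradient_coord_eq_fderiv_single (q : EuclideanSpace ℝ (Fin n) → ℝ)
    (x : EuclideanSpace ℝ (Fin n)) (i : Fin n) :
    gradient q x i = fderiv ℝ q x (EuclideanSpace.single i 1) := by
  have h := EuclideanSpace.inner_single_right i (1 : ℝ) (gradient q x)
  rw [inner_gradient_left] at h
  simpa using h.symm

/-- `∇(-q) = -∇q`. [folklore] -/
private theorem gradient_fun_neg (q : EuclideanSpace ℝ (Fin n) → ℝ) (x : EuclideanSpace ℝ (Fin n)) :
    gradient (fun y => -q y) x = -gradient q x := by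
  ext i
  rw [gradient_coord_eq_fderiv_single, fderiv_fun_neg, PiLp.neg_apply,
    gradient_coord_eq_fderiv_single]
  rfl

/-- `∇²(-q) = -∇²q` (no differentiability needed). [folklore] -/
theorem hessianMatrix_fun_neg (q : EuclideanSpace ℝ (Fin n) → ℝ) (x : EuclideanSpace ℝ (Fin n)) :
    hessianMatrix (fun y => -q y) x = -hessianMatrix q x := by
  ext i j
  rw [hessianMatrix_apply, Matrix.neg_apply, hessianMatrix_apply,
    show (fun y => -q y) = -q from rfl, iteratedFDeriv_neg_apply]
  rfl

/-- `∇(c q) = c ∇q` for a constant `c`, no differentiability needed (the tree's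
`gradient_const_smul_field`, in `fun`-form). [folklore] -/
private theorem gradient_fun_const_mul (c : ℝ) (q : EuclideanSpace ℝ (Fin n) → ℝ)
    (x : EuclideanSpace ℝ (Fin n)) :
    gradient (fun y => c * q y) x = c • gradient q x :=
  gradient_const_smul_field q c x

/-- `∇²(c q) = c ∇²q` for a constant `c`, with NO differentiability hypothesis (`c = 0` or
invertible: Mathlib's `fderiv_const_smul_field` twice); the tree's `hessianMatrix_const_mul`
assumes `C²` at `x`. [folklore] -/
theorem hessianMatrix_const_mul' (c : ℝ) (q : EuclideanSpace ℝ (Fin n) → ℝ)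
    (x : EuclideanSpace ℝ (Fin n)) :
    hessianMatrix (fun y => c * q y) x = c • hessianMatrix q x := by
  ext i j
  rw [hessianMatrix_apply_eq_fderiv_fderiv, Matrix.smul_apply,
    hessianMatrix_apply_eq_fderiv_fderiv, show (fun y => c * q y) = c • q from rfl,
    fderiv_const_smul_field (𝕜 := ℝ) (f := q) c,
    fderiv_const_smul_field (𝕜 := ℝ) (f := fderiv ℝ q) c]
  rfl

/-- `∇(q(λ ·))(x) = λ ∇q(λx)`. [folklore] -/
private theorem gradient_comp_const_smul (c : ℝ) (q : EuclideanSpace ℝ (Fin n) → ℝ)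
    (x : EuclideanSpace ℝ (Fin n)) :
    gradient (fun y => q (c • y)) x = c • gradient q (c • x) := by
  ext i
  rw [gradient_coord_eq_fderiv_single, PiLp.smul_apply, gradient_coord_eq_fderiv_single,
    fderiv_comp_smul]
  rfl

/-- `∇²(q(λ ·))(x) = λ² ∇²q(λx)` (no differentiability needed). [folklore] -/
theorem hessianMatrix_comp_smul (c : ℝ) (q : EuclideanSpace ℝ (Fin n) → ℝ)
    (x : EuclideanSpace ℝ (Fin n)) :
    hessianMatrix (fun y => q (c • y)) x = c ^ 2 • hessianMatrix q (c • x) := by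
  ext i j
  rw [hessianMatrix_apply_eq_fderiv_fderiv, Matrix.smul_apply,
    hessianMatrix_apply_eq_fderiv_fderiv]
  have h1 : fderiv ℝ (fun y => q (c • y)) = c • fun y => fderiv ℝ q (c • y) := by
    funext y; rw [fderiv_comp_smul]; rfl
  rw [h1, fderiv_const_smul_field (𝕜 := ℝ) (f := fun y => fderiv ℝ q (c • y)) c, Pi.smul_apply,
    fderiv_comp_smul]
  simp only [FunLike.coe_smul, Pi.smul_apply, smul_eq_mul]
  ring

/-- `∇(q(· + v))(x) = ∇q(x + v)`. [folklore] -/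
private theorem gradient_comp_add_right (v : EuclideanSpace ℝ (Fin n))
    (q : EuclideanSpace ℝ (Fin n) → ℝ) (x : EuclideanSpace ℝ (Fin n)) :
    gradient (fun y => q (y + v)) x = gradient q (x + v) := by
  ext i
  rw [gradient_coord_eq_fderiv_single, gradient_coord_eq_fderiv_single, fderiv_comp_add_right]

/-- `∇²(q(· + v))(x) = ∇²q(x + v)` (no differentiability needed). [folklore] -/
theorem hessianMatrix_comp_add_right (v : EuclideanSpace ℝ (Fin n))
    (q : EuclideanSpace ℝ (Fin n) → ℝ) (x : EuclideanSpace ℝ (Fin n)) :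
    hessianMatrix (fun y => q (y + v)) x = hessianMatrix q (x + v) := by
  ext i j
  rw [hessianMatrix_apply, hessianMatrix_apply, iteratedFDeriv_comp_add_right]

end Hessian

/-! ### The density and the budget -/

/-- The **isobar Euler density** of `q : ℝ³ → ℝ` at `x`:
`⟨∇q(x), adj(∇²q(x)) ∇q(x)⟩ / ‖∇q(x)‖³` — in coordinates `gᵀ adj(∇²q(x)) g / ‖g‖³` with
`g = WithLp.ofLp (∇q(x)) : Fin 3 → ℝ`, `∇²q(x) = Literature.Geometry.Riemannian.hessianMatrix q x`
(the tree's Hessian matrix in the standard basis) and `adj = Matrix.adjugate`. This is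
`K_Σ(x) · ‖∇q(x)‖` (`isobarEulerDensity_eq_gaussCurvature_mul_norm`), `K_Σ` being Goldman's formula
`K_G = ∇F · H*(F) · ∇Fᵀ / |∇F|⁴` (`H*` the adjugate of the Hessian; the tree's
`levelSetGaussCurvature`) for the Gauss curvature of the level surface `Σ = {q = q(x)}` through a
regular point `x`, times the coarea factor `|∇q|`. Junk value `0` where `∇q(x) = 0` (division by
zero) or where `q` is not (twice) differentiable.
[cite: Goldman2005, eq. (4.1), Thm 4.1 (p. 642)] -/
def isobarEulerDensity (q : EuclideanSpace ℝ (Fin 3) → ℝ) (x : EuclideanSpace ℝ (Fin 3)) : ℝ :=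
  ofLp (gradient q x) ⬝ᵥ ((hessianMatrix q x).adjugate *ᵥ ofLp (gradient q x)) /
    ‖gradient q x‖ ^ 3

/-- The **isobar Euler budget** of `q : ℝ³ → ℝ` between the levels `a` and `b`:
`B(q; a, b) = 2 ∫_{a < q < b} ⟨∇q, adj(∇²q) ∇q⟩ / ‖∇q‖³ dx`, the Bochner integral of
`isobarEulerDensity q` for Lebesgue measure on the open slab `q⁻¹(a, b)` (junk value `0` if the
density is not integrable there; `0` for `b ≤ a`). For `q ∈ C²` and a.e. `s ∈ (a, b)` a regular
value with compact level set `Σ_s = {q = s}`, the coarea formula and Gauss–Bonnet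
(`∫_{Σ_s} K_Σ dσ = 2π χ(Σ_s)`) give `B(q; a, b) = 2 ∫_a^b ∫_{Σ_s} K_Σ dσ ds = 4π ∫_a^b χ(Σ_s) ds`
(Stern's level-set method, §2: "by the coarea formula and the Gauss–Bonnet theorem"); that
identity is not asserted here. Sanity values proved below: `B(‖·‖²; a, b) = 8π(b - a)`
(spheres, `χ = 2`), `B = 0` for `z`-invariant `q` (cylinders),
`B(λ²q(λ·); λ²a, λ²b) = λ²B(q; a, b)`.
[cite: Stern2022, §2 (coarea formula + Gauss–Bonnet on regular level sets)] -/
def isobarEulerBudget (q : EuclideanSpace ℝ (Fin 3) → ℝ) (a b : ℝ) : ℝ :=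
  2 * ∫ x in q ⁻¹' Ioo a b, isobarEulerDensity q x

/-- Unfolding the budget. [folklore] -/
theorem isobarEulerBudget_def (q : EuclideanSpace ℝ (Fin 3) → ℝ) (a b : ℝ) :
    isobarEulerBudget q a b = 2 * ∫ x in q ⁻¹' Ioo a b, isobarEulerDensity q x := rfl

/-- Unfolding the density. [folklore] -/
theorem isobarEulerDensity_def (q : EuclideanSpace ℝ (Fin 3) → ℝ) (x : EuclideanSpace ℝ (Fin 3)) :
    isobarEulerDensity q x =
      ofLp (gradient q x) ⬝ᵥ ((hessianMatrix q x).adjugate *ᵥ ofLp (gradient q x)) /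
        ‖gradient q x‖ ^ 3 := rfl

/-- The inner-product reading of the numerator: `gᵀ adj(∇²q) g = ⟨∇q, adj(∇²q) ∇q⟩` with the
matrix acting through the standard basis (`EuclideanSpace.inner_eq_star_dotProduct`). [folklore] -/
theorem isobarEulerDensity_eq_inner (q : EuclideanSpace ℝ (Fin 3) → ℝ)
    (x : EuclideanSpace ℝ (Fin 3)) :
    isobarEulerDensity q x =
      ⟪gradient q x, toLp 2 ((hessianMatrix q x).adjugate *ᵥ ofLp (gradient q x))⟫ /
        ‖gradient q x‖ ^ 3 := by
  rw [isobarEulerDensity, EuclideanSpace.inner_eq_star_dotProduct, star_trivial, ofLp_toLp,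
    dotProduct_comm]

/-- At a critical point the density vanishes (the documented junk value). [folklore] -/
theorem isobarEulerDensity_eq_zero_of_gradient_eq_zero {q : EuclideanSpace ℝ (Fin 3) → ℝ}
    {x : EuclideanSpace ℝ (Fin 3)} (hx : gradient q x = 0) : isobarEulerDensity q x = 0 := by
  simp [isobarEulerDensity, hx]

/-- An empty slab (`b ≤ a`) has zero budget. [folklore] -/
theorem isobarEulerBudget_of_le (q : EuclideanSpace ℝ (Fin 3) → ℝ) {a b : ℝ} (h : b ≤ a) :
    isobarEulerBudget q a b = 0 := by
  simp [isobarEulerBudget, Ioo_eq_empty_of_le h]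

/-! #### Reading through Goldman's curvature and the level-set Gauss–Bonnet fact -/

/-- **The density is Goldman's Gauss curvature times the coarea factor**:
`isobarEulerDensity q x = K_Σ(x) · ‖∇q(x)‖` with `K_Σ = levelSetGaussCurvature q x`, the Gauss
curvature of the level surface through `x` (Goldman 2005, Thm 4.1; both sides `0` at critical
points). [cite: Goldman2005, eq. (4.1), Thm 4.1 (p. 642)] -/
theorem isobarEulerDensity_eq_gaussCurvature_mul_norm (q : EuclideanSpace ℝ (Fin 3) → ℝ)
    (x : EuclideanSpace ℝ (Fin 3)) :
    isobarEulerDensity q x = levelSetGaussCurvature q x * ‖gradient q x‖ :=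
  (levelSetGaussCurvature_mul_norm q x).symm

/-- **`B(q; a, b) = 4π ∫_{[a,b]} χ(Σ_s) ds` on a regular compact slab**, read through the named fact
`Literature.Geometry.Riemannian.levelSet_gaussBonnet_coarea` (coarea + Gauss–Bonnet, Stern 2022
§2; taken as the hypothesis `h`, NOT proved in the tree): for `q` smooth with `q⁻¹[a, b]` compact
and free of critical points, the budget is `4π` times the integral of the Euler characteristics
`χ(Σ_s) = levelSetEulerChar q s` of the level sets. This is `levelSet_gaussBonnet_coarea.slab_Ioo`
with the integrand folded into `isobarEulerDensity`.
[cite: Stern2022, §2, proof of Thm. 1.1 (coarea + Gauss–Bonnet step)] -/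
theorem isobarEulerBudget_eq_of_gaussBonnet (h : levelSet_gaussBonnet_coarea)
    {q : EuclideanSpace ℝ (Fin 3) → ℝ} (hq : ContDiff ℝ ∞ q) {a b : ℝ}
    (hK : IsCompact (q ⁻¹' Icc a b)) (hreg : ∀ x ∈ q ⁻¹' Icc a b, gradient q x ≠ 0) :
    isobarEulerBudget q a b = 4 * Real.pi * ∫ s in Icc a b, (levelSetEulerChar q s : ℝ) :=
  levelSet_gaussBonnet_coarea.slab_Ioo h hq hK hreg

/-! #### A quadratic-form lemma for the adjugate -/

/-- If the `k`-th column of a `3 × 3` matrix `M` vanishes and `g_k = 0`, then `gᵀ adj(M) g = 0`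
(only the `k`-th row of `adj(M)` survives: `M adj(M) = det(M) I = 0` puts the columns of `adj(M)` in
`ker M ∋ e_k`). Proved by expanding `Matrix.adjugate_fin_three`. [folklore] -/
theorem dotProduct_adjugate_mulVec_eq_zero (M : Matrix (Fin 3) (Fin 3) ℝ) (g : Fin 3 → ℝ)
    (k : Fin 3) (hM : ∀ i, M i k = 0) (hg : g k = 0) : g ⬝ᵥ (M.adjugate *ᵥ g) = 0 := by
  have h0 := hM 0; have h1 := hM 1; have h2 := hM 2
  fin_cases k <;>
  · simp only [Fin.zero_eta, Fin.mk_one, Fin.reduceFinMk, Fin.isValue] at h0 h1 h2 hg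
    simp [Matrix.adjugate_fin_three, dotProduct, Matrix.mulVec, Fin.sum_univ_three, h0, h1, h2, hg]

/-! #### Symmetries of the density and of the budget -/

/-- **Orientation**: the density of `-q` equals that of `q` (`adj(-M) = adj(M)` for `3 × 3`
matrices; the Gauss curvature of a surface does not depend on the choice of normal). [folklore] -/
theorem isobarEulerDensity_fun_neg (q : EuclideanSpace ℝ (Fin 3) → ℝ)
    (x : EuclideanSpace ℝ (Fin 3)) :
    isobarEulerDensity (fun y => -q y) x = isobarEulerDensity q x := by
  simp only [isobarEulerDensity, gradient_fun_neg, hessianMatrix_fun_neg, WithLp.ofLp_neg, norm_neg]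
  rw [show -hessianMatrix q x = (-1 : ℝ) • hessianMatrix q x by simp, Matrix.adjugate_smul]
  simp [neg_dotProduct, dotProduct_neg, Matrix.mulVec_neg]

/-- **Orientation**: `B(-q; -b, -a) = B(q; a, b)` (the slabs coincide and so do the densities;
`χ(Σ_s)` is orientation blind). [folklore] -/
theorem isobarEulerBudget_fun_neg (q : EuclideanSpace ℝ (Fin 3) → ℝ) (a b : ℝ) :
    isobarEulerBudget (fun y => -q y) (-b) (-a) = isobarEulerBudget q a b := by
  have hset : (fun y => -q y) ⁻¹' Ioo (-b) (-a) = q ⁻¹' Ioo a b := by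
    ext y; simp [and_comm]
  simp only [isobarEulerBudget, hset, isobarEulerDensity_fun_neg]

/-- **Amplitude**: the density of `c q` is `|c|` times that of `q` (`∇ ↦ c∇`, `adj ∇² ↦ c² adj ∇²`,
numerator `c⁴`, denominator `|c|³`). [folklore] -/
theorem isobarEulerDensity_const_mul (c : ℝ) (q : EuclideanSpace ℝ (Fin 3) → ℝ)
    (x : EuclideanSpace ℝ (Fin 3)) :
    isobarEulerDensity (fun y => c * q y) x = |c| * isobarEulerDensity q x := by
  simp only [isobarEulerDensity, gradient_fun_const_mul, hessianMatrix_const_mul',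
    WithLp.ofLp_smul, Matrix.adjugate_smul, Fintype.card_fin, Nat.reduceSub]
  set g := ofLp (gradient q x)
  set A := (hessianMatrix q x).adjugate
  have hnum : (c • g) ⬝ᵥ ((c ^ 2 • A) *ᵥ (c • g)) = c ^ 4 * (g ⬝ᵥ (A *ᵥ g)) := by
    rw [smul_dotProduct, Matrix.smul_mulVec, Matrix.mulVec_smul, dotProduct_smul, dotProduct_smul]
    simp only [smul_eq_mul]
    ring
  have hden : ‖c • gradient q x‖ ^ 3 = |c| ^ 3 * ‖gradient q x‖ ^ 3 := by
    rw [norm_smul, Real.norm_eq_abs, mul_pow]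
  rw [hnum, hden]
  rcases eq_or_ne c 0 with rfl | hc
  · simp
  · have h3 : |c| ^ 3 ≠ 0 := pow_ne_zero _ (abs_ne_zero.mpr hc)
    have h4 : c ^ 4 = |c| ^ 3 * |c| := by
      rw [← pow_succ, show (3 + 1 : ℕ) = 2 * 2 from rfl, pow_mul, sq_abs]; ring
    rw [h4, mul_assoc, mul_div_mul_left _ _ h3, mul_div_assoc]

/-- **Amplitude**: `B(cq; ca, cb) = c B(q; a, b)` for `c > 0` — consistent with `4π ∫_a^b χ ds`
(`ds ↦ c ds`). [folklore] -/
theorem isobarEulerBudget_const_mul {c : ℝ} (hc : 0 < c) (q : EuclideanSpace ℝ (Fin 3) → ℝ)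
    (a b : ℝ) :
    isobarEulerBudget (fun y => c * q y) (c * a) (c * b) = c * isobarEulerBudget q a b := by
  have hset : (fun y => c * q y) ⁻¹' Ioo (c * a) (c * b) = q ⁻¹' Ioo a b := by
    ext y; simp [mul_lt_mul_iff_right₀ hc]
  simp only [isobarEulerBudget, hset, isobarEulerDensity_const_mul, abs_of_pos hc,
    integral_const_mul]
  ring

/-- **Dilation**: the density of `q(λ ·)` at `x` is `|λ|³` times the density of `q` at `λx`
(`∇ ↦ λ∇`, `∇² ↦ λ²∇²`, numerator `λ⁶`, denominator `|λ|³`). [folklore] -/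
theorem isobarEulerDensity_comp_smul (c : ℝ) (q : EuclideanSpace ℝ (Fin 3) → ℝ)
    (x : EuclideanSpace ℝ (Fin 3)) :
    isobarEulerDensity (fun y => q (c • y)) x = |c| ^ 3 * isobarEulerDensity q (c • x) := by
  simp only [isobarEulerDensity, gradient_comp_const_smul, hessianMatrix_comp_smul,
    WithLp.ofLp_smul, Matrix.adjugate_smul, Fintype.card_fin, Nat.reduceSub]
  set g := ofLp (gradient q (c • x))
  set A := (hessianMatrix q (c • x)).adjugate
  have hnum : (c • g) ⬝ᵥ (((c ^ 2) ^ 2 • A) *ᵥ (c • g)) = c ^ 6 * (g ⬝ᵥ (A *ᵥ g)) := by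
    rw [smul_dotProduct, Matrix.smul_mulVec, Matrix.mulVec_smul, dotProduct_smul, dotProduct_smul]
    simp only [smul_eq_mul]
    ring
  have hden : ‖c • gradient q (c • x)‖ ^ 3 = |c| ^ 3 * ‖gradient q (c • x)‖ ^ 3 := by
    rw [norm_smul, Real.norm_eq_abs, mul_pow]
  rw [hnum, hden]
  rcases eq_or_ne c 0 with rfl | hc
  · simp
  · have h3 : |c| ^ 3 ≠ 0 := pow_ne_zero _ (abs_ne_zero.mpr hc)
    have h6 : c ^ 6 = |c| ^ 3 * |c| ^ 3 := by
      rw [← pow_add, show (3 + 3 : ℕ) = 3 * 2 from rfl, pow_mul', sq_abs]; ring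
    rw [h6, mul_assoc, mul_div_mul_left _ _ h3, mul_div_assoc]

/-- **Dilation**: `B(q(λ ·); a, b) = B(q; a, b)` for `λ > 0` (the Jacobian `λ⁻³` cancels the
`λ³` of the density; Euler characteristics of level sets are scale invariant). [folklore] -/
theorem isobarEulerBudget_comp_smul {c : ℝ} (hc : 0 < c) (q : EuclideanSpace ℝ (Fin 3) → ℝ)
    (a b : ℝ) :
    isobarEulerBudget (fun y => q (c • y)) a b = isobarEulerBudget q a b := by
  have hset : (fun y => q (c • y)) ⁻¹' Ioo a b = (fun y => c • y) ⁻¹' (q ⁻¹' Ioo a b) := rfl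
  simp only [isobarEulerBudget, isobarEulerDensity_comp_smul, integral_const_mul, hset]
  rw [Measure.setIntegral_comp_smul_of_pos volume (isobarEulerDensity q) _ hc,
    Set.preimage_smul₀ hc.ne', smul_inv_smul₀ hc.ne', finrank_euclideanSpace_fin, abs_of_pos hc,
    smul_eq_mul, mul_inv_cancel_left₀ (pow_ne_zero _ hc.ne')]

/-- **Navier–Stokes scaling**: `B(λ² q(λ ·); λ² a, λ² b) = λ² B(q; a, b)` for `λ > 0` — the budget
has the dimension of `q` (a pressure), so its time integral is scaling-critical. [folklore] -/
theorem isobarEulerBudget_nsScaling {c : ℝ} (hc : 0 < c) (q : EuclideanSpace ℝ (Fin 3) → ℝ)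
    (a b : ℝ) :
    isobarEulerBudget (fun y => c ^ 2 * q (c • y)) (c ^ 2 * a) (c ^ 2 * b) =
      c ^ 2 * isobarEulerBudget q a b := by
  rw [isobarEulerBudget_const_mul (pow_pos hc 2) (fun y => q (c • y)),
    isobarEulerBudget_comp_smul hc]

/-- **Translation**: the density of `q(· + v)` at `x` is the density of `q` at `x + v`.
[folklore] -/
theorem isobarEulerDensity_comp_add_right (v : EuclideanSpace ℝ (Fin 3))
    (q : EuclideanSpace ℝ (Fin 3) → ℝ) (x : EuclideanSpace ℝ (Fin 3)) :
    isobarEulerDensity (fun y => q (y + v)) x = isobarEulerDensity q (x + v) := by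
  simp only [isobarEulerDensity, gradient_comp_add_right, hessianMatrix_comp_add_right]

/-- **Translation**: `B(q(· + v); a, b) = B(q; a, b)` (Lebesgue measure is translation
invariant). [folklore] -/
theorem isobarEulerBudget_comp_add_right (v : EuclideanSpace ℝ (Fin 3))
    (q : EuclideanSpace ℝ (Fin 3) → ℝ) (a b : ℝ) :
    isobarEulerBudget (fun y => q (y + v)) a b = isobarEulerBudget q a b := by
  simp only [isobarEulerBudget, isobarEulerDensity_comp_add_right]
  congr 1
  exact (measurePreserving_add_right volume v).setIntegral_preimage_emb
    (MeasurableEquiv.addRight v).measurableEmbedding (isobarEulerDensity q) (q ⁻¹' Ioo a b)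

/-! #### Fields invariant in a coordinate direction (columns, `z`-invariant fields) -/

/-- **Columns.** If `∂_k q ≡ 0` for a coordinate direction `e_k` then the density vanishes
identically: `g_k = 0` and the `k`-th column of `∇²q` vanishes (`∂ᵢ∂_k q = ∂ᵢ 0`), so
`gᵀ adj(∇²q) g = 0` by `dotProduct_adjugate_mulVec_eq_zero` — the pointwise form of "cylindrical
isobars carry no Gauss curvature". [folklore] -/
theorem isobarEulerDensity_eq_zero_of_fderiv_apply_single_eq_zero
    {q : EuclideanSpace ℝ (Fin 3) → ℝ} (k : Fin 3)
    (h : ∀ y, fderiv ℝ q y (EuclideanSpace.single k 1) = 0) (x : EuclideanSpace ℝ (Fin 3)) :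
    isobarEulerDensity q x = 0 := by
  have hg : ofLp (gradient q x) k = 0 := by
    change gradient q x k = 0
    rw [gradient_coord_eq_fderiv_single, h]
  have hM : ∀ i, hessianMatrix q x i k = 0 := by
    intro i
    rw [hessianMatrix_apply_eq_fderiv_fderiv]
    by_cases hd : DifferentiableAt ℝ (fderiv ℝ q) x
    · have key : fderiv ℝ (fun y => fderiv ℝ q y (EuclideanSpace.single k 1)) x
          (EuclideanSpace.single i 1) =
          fderiv ℝ (fderiv ℝ q) x (EuclideanSpace.single i 1) (EuclideanSpace.single k 1) := by
        rw [fderiv_clm_apply hd (differentiableAt_const _)]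
        simp
      rw [← key, show (fun y => fderiv ℝ q y (EuclideanSpace.single k 1)) = fun _ => (0 : ℝ) from
        funext h, fderiv_const_apply]
      rfl
    · rw [fderiv_zero_of_not_differentiableAt hd]
      rfl
  rw [isobarEulerDensity, dotProduct_adjugate_mulVec_eq_zero _ _ k hM hg, zero_div]

/-- If `q` is invariant under translations in the coordinate direction `e_k` then `∂_k q ≡ 0`
(line derivative of a constant; junk `0` where `q` is not differentiable). [folklore] -/
theorem fderiv_apply_single_eq_zero_of_invariant {q : EuclideanSpace ℝ (Fin 3) → ℝ} (k : Fin 3)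
    (h : ∀ y (t : ℝ), q (y + t • EuclideanSpace.single k 1) = q y) (y : EuclideanSpace ℝ (Fin 3)) :
    fderiv ℝ q y (EuclideanSpace.single k 1) = 0 := by
  by_cases hd : DifferentiableAt ℝ q y
  · rw [← hd.lineDeriv_eq_fderiv, lineDeriv]
    simp only [h, deriv_const]
  · rw [fderiv_zero_of_not_differentiableAt hd]; rfl

/-- **`z`-invariant fields have zero budget**: if `q(y + t e_k) = q(y)` for all `y, t` (e.g.
`q(x, y, z) = q₀(x, y)` with `k = 2`), then `B(q; a, b) = 0` for all levels — the regular level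
sets are cylinders, `χ = 0`. [folklore] -/
theorem isobarEulerBudget_eq_zero_of_invariant {q : EuclideanSpace ℝ (Fin 3) → ℝ} (k : Fin 3)
    (h : ∀ y (t : ℝ), q (y + t • EuclideanSpace.single k 1) = q y) (a b : ℝ) :
    isobarEulerBudget q a b = 0 := by
  have hz : ∀ x, isobarEulerDensity q x = 0 :=
    isobarEulerDensity_eq_zero_of_fderiv_apply_single_eq_zero k
      (fderiv_apply_single_eq_zero_of_invariant k h)
  simp [isobarEulerBudget, hz]

/-! #### The round example `q = ‖·‖²` -/

section Radial

/-- **The density of `‖·‖²` is `2 / ‖x‖`**: each sphere `‖x‖ = r` has `K = 1/r²` (the tree's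
`levelSetGaussCurvature_norm_sq`, Goldman 2005 Example 4.1) and `|∇q| = 2r`. [folklore] -/
theorem isobarEulerDensity_norm_sq (x : EuclideanSpace ℝ (Fin 3)) :
    isobarEulerDensity (fun y : EuclideanSpace ℝ (Fin 3) => ‖y‖ ^ 2) x = 2 / ‖x‖ := by
  rw [isobarEulerDensity_eq_gaussCurvature_mul_norm, gradient_norm_sq, norm_smul, Real.norm_ofNat]
  rcases eq_or_ne x 0 with rfl | hx
  · simp
  · have hn : ‖x‖ ≠ 0 := norm_ne_zero_iff.2 hx
    rw [levelSetGaussCurvature_norm_sq hx]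
    field_simp

/-- **The round example.** For `q = ‖·‖²` and `0 ≤ a ≤ b`: `B(q; a, b) = 8π (b - a)` — every level
set `{‖x‖² = s}`, `s > 0`, is a round sphere, `χ = 2`, and `4π ∫_a^b 2 ds = 8π(b - a)`; here
computed unconditionally from the definition by polar coordinates
(`∫_{a<‖x‖²<b} 2/‖x‖ dx = 4π ∫_{√a}^{√b} 2r dr`, Mathlib's `integral_fun_norm_addHaar` and
`EuclideanSpace.volume_ball_fin_three`). [folklore] -/
theorem isobarEulerBudget_norm_sq {a b : ℝ} (ha : 0 ≤ a) (hab : a ≤ b) :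
    isobarEulerBudget (fun y : EuclideanSpace ℝ (Fin 3) => ‖y‖ ^ 2) a b =
      8 * Real.pi * (b - a) := by
  rw [isobarEulerBudget]
  simp only [isobarEulerDensity_norm_sq]
  set S : Set (EuclideanSpace ℝ (Fin 3)) :=
    (fun y : EuclideanSpace ℝ (Fin 3) => ‖y‖ ^ 2) ⁻¹' Ioo a b with hS_def
  have hS : MeasurableSet S :=
    measurableSet_Ioo.preimage (continuous_norm.pow 2).measurable
  -- the integrand as a function of the norm
  set F : ℝ → ℝ := fun r => if r ^ 2 ∈ Ioo a b then 2 / r else 0 with hF_def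
  have hind : S.indicator (fun x : EuclideanSpace ℝ (Fin 3) => 2 / ‖x‖) = fun x => F ‖x‖ := by
    funext x
    by_cases hx : ‖x‖ ^ 2 ∈ Ioo a b
    · have hxS : x ∈ S := hx
      rw [Set.indicator_of_mem hxS]
      simp only [hF_def]
      rw [if_pos hx]
    · have hxS : x ∉ S := hx
      rw [Set.indicator_of_notMem hxS]
      simp only [hF_def]
      rw [if_neg hx]
  rw [← integral_indicator hS, hind, integral_fun_norm_addHaar volume F]
  -- the radial integral
  have hrad : ∫ y in Ioi (0 : ℝ), y ^ (Module.finrank ℝ (EuclideanSpace ℝ (Fin 3)) - 1) • F y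
      = b - a := by
    rw [finrank_euclideanSpace_fin]
    have hcongr : ∀ y ∈ Ioi (0 : ℝ), y ^ (3 - 1) • F y =
        (Ioo (Real.sqrt a) (Real.sqrt b)).indicator (fun y => 2 * y) y := by
      intro y hy
      have hy : 0 < y := hy
      by_cases hmem : y ∈ Ioo (Real.sqrt a) (Real.sqrt b)
      · have h2 : y ^ 2 ∈ Ioo a b := by
          constructor
          · exact (Real.sqrt_lt' hy).mp hmem.1
          · exact (Real.lt_sqrt hy.le).mp hmem.2
        rw [Set.indicator_of_mem hmem, hF_def]
        simp only [h2, if_true, smul_eq_mul]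
        field_simp
      · have h2 : y ^ 2 ∉ Ioo a b := by
          intro h2
          exact hmem ⟨(Real.sqrt_lt' hy).mpr h2.1, (Real.lt_sqrt hy.le).mpr h2.2⟩
        rw [Set.indicator_of_notMem hmem, hF_def]
        simp [h2]
    rw [setIntegral_congr_fun measurableSet_Ioi hcongr, setIntegral_indicator measurableSet_Ioo,
      show Ioi (0 : ℝ) ∩ Ioo (Real.sqrt a) (Real.sqrt b) = Ioo (Real.sqrt a) (Real.sqrt b) from
        Set.inter_eq_right.mpr fun y hy => lt_of_le_of_lt (Real.sqrt_nonneg a) hy.1,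
      ← integral_Ioc_eq_integral_Ioo,
      ← intervalIntegral.integral_of_le (Real.sqrt_le_sqrt hab),
      intervalIntegral.integral_const_mul, integral_id, Real.sq_sqrt ha,
      Real.sq_sqrt (ha.trans hab)]
    ring
  rw [hrad, finrank_euclideanSpace_fin, Measure.real, EuclideanSpace.volume_ball_fin_three,
    ENNReal.toReal_mul, ← ENNReal.ofReal_pow zero_le_one, one_pow,
    ENNReal.toReal_ofReal zero_le_one,
    ENNReal.toReal_ofReal (by positivity), nsmul_eq_mul, smul_eq_mul, Nat.cast_ofNat]
  ring

end Radial

end Literature.Analysis.FluidPDE
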